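/-
Copyright (c) 2026 the pub-hodgecm-mathlib formalisation cell (harness21).  Prover seat hodgecm-mathlib-K2E4-p01 (g2), Track B ∕ K2-LIT,
h413 = `stmt-HodgeConjecture-24833`; road «(B)∣split» = Harish-Chandra density at the centre of `GL₂ × GL₁` at a split place
(K2E3-plan (g1) BATCH #2 22:15:20Z; K2E4-p02 (g0) MEMO e17c29b987bdd666 + interface (HC₁^P) 22:30:14Z∕22:32:59Z).  2026-09-03.
-/
import Literature.NumberTheory.Automorphic.SLTwoTreeQuadraticTorusEisenstein        -- ★ Eisenstein package: `quadNormForm_integral_of_eisenstein`, shell counts, `relIndex_torusInt_shellStab_eq`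
import Literature.NumberTheory.Automorphic.SLTwoTreeQuadraticTorusShellIndex        -- ★ `exists_shellIndex` (the shell index `d`), shell decomposition ∕ uniqueness
import Literature.NumberTheory.Automorphic.SLTwoTreeQuadraticTorusShellValues       -- ★ `exists_units_mul_glInt_of_glVertexAct_eq`, `coe_inv_mul_torus_mul_of_coe_eq_diagonal`
import Literature.NumberTheory.Automorphic.GLnIwahoriBorelFactorization             -- ★ `mem_congruenceGL_of_valBound_sub_one` (+ `GLnCongruenceSubgroups`: `congruenceGL`, `ValBound`)
import HarnessLib

/-!
# h413 ∕ Track B «K2-LIT» — HC density at the centre of `GL₂(F) × GL₁(F)`, FILE A: the RAMIFIED SHELL SHIFT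
# `r_{r+1}⁻¹ γ_{n+1} r_{r+1} ∈ (r_r⁻¹ γ_n r_r) · K(ϖⁿ)` for the deep elements `γ_n = z(1 + ϖⁿ τ)` of an Eisenstein torus

Cell `pub/hodgecm-mathlib`, crux H413 = `stmt-HodgeConjecture-24833` (supports-only), route `HCCMUnconditional`; E3 socket (B)
`sig_K2E3CentralTransferVanishing` of `Lines/K2_E3_EllipticInputsSigs_U3bCentralGerms.lean` at a SPLIT place, reduced by K2E4-p02 (g0)'s T0 to
(HC₁^P) «`ψ ∈ C_c^∞(GL₂(F) × GL₁(F))` with vanishing quotient-Haar orbital integrals at the elliptic-regular classes vanishes at the centre».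
THIS FILE (pure algebra over a valued field `F`, uniformiser `ϖ`, Eisenstein torus `τ² = uτ + v`, `|u| < 1`, `|v| = |ϖ|`):

* §1 `valuation_deepDet_eq_one`, **`exists_shellConj_succ_eq_mul_of_mem_congruenceGL`** — for `γ_n := z·(1 + ϖⁿ γτ)` (matrix `(z, zϖⁿv; zϖⁿ, z + zϖⁿu)`)
  and the shell representatives `r_m = diag(1, ϖ^m)` [LabesseLanglands1979 §2 p. 8], for EVERY `r ≥ 0` and `n ≥ 1`:
  `r_{r+1}⁻¹ γ_{n+1} r_{r+1} = (r_r⁻¹ γ_n r_r) · k` with `k ∈ congruenceGL 2 |ϖ|ⁿ` — the dangerous entry `ϖⁿ·ϖ^{−r}` is SHARED by the two shell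
  conjugates, so their quotient is `≡ 1 (mod ϖⁿ)` uniformly in `r`; and `γ_{n+1} = (z·1) · k₀`, `k₀ ∈ congruenceGL 2 |ϖ|ⁿ` (`exists_deep_eq_scalar_mul_of_mem_congruenceGL`).
* §2 the torus as a centraliser: `centralizer_deep_eq_centralizer_companion` (`C(γ_n) = C(γτ)`), `commute_of_mem_centralizer_companion`,
  `mem_glInt_of_mem_centralizer_companion_of_shellConj_mem` (`t ∈ C(γτ)`, `r_m⁻¹ t r_m ∈ GL₂(𝒪) ⇒ t ∈ GL₂(𝒪)`),
  `disc_deep_eq` ∕ `eval_charpoly_deep_ne_zero` (the two regularity guards of (HC₁^P) at `(γ_n, c)`).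

Consumed by FILE B (`K2E3GLTwoRamifiedShellUnfolding`: the Laumon unfolding of the orbital integral at `(γ_n, c)` as a shell sum with weights `q^r`)
and FILE C (`K2E3GLTwoCentralDensityRamifiedTorus`: the recursion `S_{n+1} − q S_n = ψ(z, c)` and (HC₁^P)).
HONEST LABEL: HC_CM is proved only modulo the 7 printed citations (2 remaining named inputs: hLiu418 = `stmt-HodgeConjecture-24832`,
h413 = `stmt-HodgeConjecture-24833`) until rung 0 closes; this file is elementary matrix algebra and moves no counter.

## References
* [LabesseLanglands1979] J.-P. Labesse, R. P. Langlands, *L-indistinguishability for SL(2)*, Canad. J. Math. 31 (1979), §2 pp. 7–8, (2.1).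
* [HarishChandra1999AdmissibleDistributions] Harish-Chandra (notes by DeBacker–Sally), *Admissible invariant distributions on reductive p-adic groups*,
  AMS ULS 16 (1999), Thm. 3.1 (density of regular orbital integrals).
* [Rogawski1990] J. D. Rogawski, *Automorphic Representations of Unitary Groups in Three Variables* (1990), §8.1 p. 116 (`Γ₁ ≠ 0`).
-/

set_option autoImplicit false
set_option linter.dupNamespace false

noncomputable section

open scoped ValuativeRel Matrix MatrixGroups
open Matrix ValuativeRel
open Literature.NumberTheory.Automorphic Literature.NumberTheory.Automorphic.HermitianLatticeTree Literature.NumberTheory.LocalFields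

namespace Summit.HodgeConjecture.HodgeConjecture.Cruxes.H413.K2E3GLTwoRamifiedShellShift

variable {F : Type*} [Field F] [ValuativeRel F] {ϖ : F} (hϖ : IsUniformizingElement ϖ)

/-! ## §1 The deep torus elements `γ_n = z(1 + ϖⁿτ)` and the shift of their shell conjugates -/

section Shift

include hϖ in
/-- `|1 + ϖⁿu − ϖ^{2n}v| = 1` for `u v ∈ 𝒪`, `n ≥ 1` (the reduced norm of the one-unit `1 + ϖⁿτ`). [cite: LabesseLanglands1979, §2 p. 7] -/
theorem valuation_deepDet_eq_one {u v : F} (hu : u ∈ 𝒪[F]) (hv : v ∈ 𝒪[F]) {n : ℕ} (hn : 1 ≤ n) :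
    valuation F (1 + ϖ ^ n * u - ϖ ^ (2 * n) * v) = 1 := by
  have hϖ1 := hϖ.valuation_lt_one
  have hϖn : valuation F (ϖ ^ n) < 1 := by
    rw [map_pow]; exact pow_lt_one₀ zero_le hϖ1 (by omega)
  have h1 : valuation F (ϖ ^ n * u - ϖ ^ (2 * n) * v) < 1 := by
    refine lt_of_le_of_lt (Valuation.map_sub _ _ _) (max_lt ?_ ?_)
    · rw [map_mul]
      exact mul_lt_one_of_nonneg_of_lt_one_left zero_le hϖn ((Valuation.mem_integer_iff _ _).1 hu)
    · rw [map_mul, map_pow]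
      exact mul_lt_one_of_nonneg_of_lt_one_left zero_le (pow_lt_one₀ zero_le hϖ1 (by omega)) ((Valuation.mem_integer_iff _ _).1 hv)
  rw [add_sub_assoc, Valuation.map_one_add_of_lt _ h1]

include hϖ in
/-- **THE RAMIFIED SHELL SHIFT.**  For the deep torus elements `γ_n`, `γ_{n+1}` (matrices `(z, zϖᵐv; zϖᵐ, z + zϖᵐu)`, `m = n, n+1`) and the
shell representatives `r_r = diag(1, ϖ^r)`, `r_{r+1}`: **`r_{r+1}⁻¹ γ_{n+1} r_{r+1} = (r_r⁻¹ γ_n r_r) · k` with `k ∈ congruenceGL 2 (|ϖ|ⁿ)`** — for EVERY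
`r ≥ 0` (`n ≥ 1`, `u v ∈ 𝒪`, `z ≠ 0`).  The two shell conjugates `(z, zϖ^{n+r}v; zϖ^{n−r}, z + zϖⁿu)` and `(z, zϖ^{n+r+2}v; zϖ^{n−r}, z + zϖ^{n+1}u)`
share the (possibly large) entry `zϖ^{n−r}`; explicitly `k = (1, A; 0, 1 + B)` with `B = ϖⁿ(u(ϖ−1) − ϖⁿv(ϖ²−1))∕(1 + ϖⁿu − ϖ^{2n}v)`,
`A = ϖ^{n+r} v (ϖ² − 1 − B)`. [cite: LabesseLanglands1979, §2 (2.1) p. 8] -/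
theorem exists_shellConj_succ_eq_mul_of_mem_congruenceGL {u v : F} (hu : u ∈ 𝒪[F]) (hv : v ∈ 𝒪[F]) (z : F) {n : ℕ} (hn : 1 ≤ n)
    (r : ℕ) {γn γn' gr gr' : GL (Fin 2) F}
    (hγn : (γn : Matrix (Fin 2) (Fin 2) F) = !![z, z * ϖ ^ n * v; z * ϖ ^ n, z + z * ϖ ^ n * u])
    (hγn' : (γn' : Matrix (Fin 2) (Fin 2) F) = !![z, z * ϖ ^ (n + 1) * v; z * ϖ ^ (n + 1), z + z * ϖ ^ (n + 1) * u])
    (hgr : (gr : Matrix (Fin 2) (Fin 2) F) = Matrix.diagonal ![1, ϖ ^ r]) (hgr' : (gr' : Matrix (Fin 2) (Fin 2) F) = Matrix.diagonal ![1, ϖ ^ (r + 1)]) :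
    ∃ k : GL (Fin 2) F, k ∈ congruenceGL 2 (valuation F ϖ ^ n) ∧ gr'⁻¹ * γn' * gr' = (gr⁻¹ * γn * gr) * k := by
  have h0 := hϖ.ne_zero
  have hϖ1 := hϖ.valuation_lt_one
  have hc0 : ϖ ^ r ≠ 0 := pow_ne_zero _ h0
  have hc0' : ϖ ^ (r + 1) ≠ 0 := pow_ne_zero _ h0
  -- the two shell conjugates (LL (2.1))
  have hX := coe_inv_mul_torus_mul_of_coe_eq_diagonal u v z (z * ϖ ^ n) hγn hgr hc0
  have hX' := coe_inv_mul_torus_mul_of_coe_eq_diagonal u v z (z * ϖ ^ (n + 1)) hγn' hgr' hc0'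
  -- the determinant of the one-unit and the explicit quotient `k = (1, A; 0, 1 + B)`
  set δ : F := 1 + ϖ ^ n * u - ϖ ^ (2 * n) * v with hδ
  have hδ1 : valuation F δ = 1 := valuation_deepDet_eq_one hϖ hu hv hn
  have hδ0 : δ ≠ 0 := fun h => by rw [h, map_zero] at hδ1; exact zero_ne_one hδ1
  set W : F := u * (ϖ - 1) - ϖ ^ n * v * (ϖ ^ 2 - 1) with hW
  set B : F := ϖ ^ n * W / δ with hB
  set A : F := ϖ ^ n * v * ϖ ^ r * (ϖ ^ 2 - 1 - B) with hA
  have hBδ : B * δ = ϖ ^ n * W := div_mul_cancel₀ _ hδ0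
  set k : GL (Fin 2) F := (gr⁻¹ * γn * gr)⁻¹ * (gr'⁻¹ * γn' * gr') with hk
  refine ⟨k, ?_, by rw [hk, mul_inv_cancel_left]⟩
  -- `↑X · (1, A; 0, 1 + B) = ↑X′`
  have hcc : (ϖ ^ r)⁻¹ * ϖ ^ r = 1 := inv_mul_cancel₀ hc0
  have hmul : ((gr⁻¹ * γn * gr : GL (Fin 2) F) : Matrix (Fin 2) (Fin 2) F) * !![1, A; 0, 1 + B] =
      ((gr'⁻¹ * γn' * gr' : GL (Fin 2) F) : Matrix (Fin 2) (Fin 2) F) := by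
    rw [hX, hX', Matrix.mul_fin_two]
    ext i j
    fin_cases i <;> fin_cases j
    · simp
    · simp only [Fin.zero_eta, Fin.mk_one, of_apply, cons_val', cons_val_zero, cons_val_one, cons_val_fin_one, empty_val']
      rw [hA]; ring
    · simp only [Fin.mk_one, Fin.zero_eta, of_apply, cons_val', cons_val_zero, cons_val_one, cons_val_fin_one, empty_val', mul_zero, add_zero,
        mul_one]
      rw [pow_succ, pow_succ]
      field_simp
    · simp only [Fin.mk_one, of_apply, cons_val', cons_val_one, cons_val_fin_one, empty_val']
      rw [hA]
      linear_combination (z * ϖ ^ n * ϖ ^ n * v * (ϖ ^ 2 - 1 - B)) * hcc + z * hBδ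
  have hkM : (k : Matrix (Fin 2) (Fin 2) F) = !![1, A; 0, 1 + B] := by
    rw [hk, Units.val_mul, ← hmul, ← Matrix.mul_assoc, Units.inv_mul, Matrix.one_mul]
  -- the level: every entry of `k − 1 = (0, A; 0, B)` has valuation `≤ |ϖ|ⁿ`
  have hvn : valuation F ϖ ^ n < 1 := pow_lt_one₀ zero_le hϖ1 (by omega)
  have hWO : W ∈ 𝒪[F] := by
    rw [hW]
    exact Subring.sub_mem _ (Subring.mul_mem _ hu (Subring.sub_mem _ hϖ.mem (Subring.one_mem _)))
      (Subring.mul_mem _ (Subring.mul_mem _ (hϖ.pow_mem n) hv) (Subring.sub_mem _ (hϖ.pow_mem 2) (Subring.one_mem _)))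
  have hBv : valuation F B ≤ valuation F ϖ ^ n := by
    rw [hB, map_div₀, hδ1, div_one, map_mul, map_pow]
    exact mul_le_of_le_one_right' ((Valuation.mem_integer_iff _ _).1 hWO)
  have hB1 : valuation F B ≤ 1 := hBv.trans hvn.le
  have hAv : valuation F A ≤ valuation F ϖ ^ n := by
    rw [hA, map_mul, map_mul, map_mul, map_pow, map_pow]
    have h2 : valuation F (ϖ ^ 2 - 1 - B) ≤ 1 := by
      refine (Valuation.map_sub _ _ _).trans (max_le ((Valuation.map_sub _ _ _).trans (max_le ?_ ?_)) hB1)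
      · rw [map_pow]; exact pow_le_one₀ zero_le hϖ1.le
      · rw [map_one]
    calc valuation F ϖ ^ n * valuation F v * valuation F ϖ ^ r * valuation F (ϖ ^ 2 - 1 - B)
        ≤ valuation F ϖ ^ n * valuation F v * valuation F ϖ ^ r := mul_le_of_le_one_right' h2
      _ ≤ valuation F ϖ ^ n * valuation F v := mul_le_of_le_one_right' (pow_le_one₀ zero_le hϖ1.le)
      _ ≤ valuation F ϖ ^ n := mul_le_of_le_one_right' ((Valuation.mem_integer_iff _ _).1 hv)
  refine mem_congruenceGL_of_valBound_sub_one hvn fun i j => ?_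
  rw [hkM]
  fin_cases i <;> fin_cases j
  · simp
  · simpa using hAv
  · simp
  · simpa using hBv

include hϖ in
/-- The head term: **`γ_n = (z·1) · k₀` with `k₀ = 1 + ϖⁿ γτ ∈ congruenceGL 2 (|ϖ|ⁿ)`** (`n ≥ 1`). [cite: LabesseLanglands1979, §2 p. 8] -/
theorem exists_deep_eq_scalar_mul_of_mem_congruenceGL {u v : F} (hu : u ∈ 𝒪[F]) (hv : v ∈ 𝒪[F]) (z : F) {n : ℕ} (hn : 1 ≤ n)
    {γn zS : GL (Fin 2) F} (hγn : (γn : Matrix (Fin 2) (Fin 2) F) = !![z, z * ϖ ^ n * v; z * ϖ ^ n, z + z * ϖ ^ n * u])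
    (hzS : (zS : Matrix (Fin 2) (Fin 2) F) = !![z, 0; 0, z]) :
    ∃ k : GL (Fin 2) F, k ∈ congruenceGL 2 (valuation F ϖ ^ n) ∧ γn = zS * k := by
  have hϖ1 := hϖ.valuation_lt_one
  have hvn : valuation F ϖ ^ n < 1 := pow_lt_one₀ zero_le hϖ1 (by omega)
  set k : GL (Fin 2) F := zS⁻¹ * γn with hk
  refine ⟨k, ?_, by rw [hk, mul_inv_cancel_left]⟩
  have hmul : (zS : Matrix (Fin 2) (Fin 2) F) * !![1, ϖ ^ n * v; ϖ ^ n, 1 + ϖ ^ n * u] = (γn : Matrix (Fin 2) (Fin 2) F) := by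
    rw [hzS, hγn, Matrix.mul_fin_two]
    ext i j
    fin_cases i <;> fin_cases j <;> simp <;> ring
  have hkM : (k : Matrix (Fin 2) (Fin 2) F) = !![1, ϖ ^ n * v; ϖ ^ n, 1 + ϖ ^ n * u] := by
    rw [hk, Units.val_mul, ← hmul, ← Matrix.mul_assoc, Units.inv_mul, Matrix.one_mul]
  refine mem_congruenceGL_of_valBound_sub_one hvn fun i j => ?_
  rw [hkM]
  have hn' : valuation F (ϖ ^ n) = valuation F ϖ ^ n := map_pow _ _ _
  fin_cases i <;> fin_cases j
  · simp
  · simpa [hn'] using mul_le_of_le_one_right' (a := valuation F ϖ ^ n) ((Valuation.mem_integer_iff _ _).1 hv)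
  · simp [hn']
  · simpa [hn'] using mul_le_of_le_one_right' (a := valuation F ϖ ^ n) ((Valuation.mem_integer_iff _ _).1 hu)

end Shift

/-! ## §2 The torus `T = F[τ]^×` as the centraliser of `γτ` (and of every deep element), its commutativity and integrality test -/

section Torus

omit [ValuativeRel F] in
/-- The regular representation of `c + eτ` is `c·1 + e·γτ`. [cite: LabesseLanglands1979, §2 p. 7] -/
theorem regRep_eq_smul_one_add_smul (u v c e : F) :
    (!![c, e * v; e, c + e * u] : Matrix (Fin 2) (Fin 2) F) = c • (1 : Matrix (Fin 2) (Fin 2) F) + e • !![0, v; 1, u] := by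
  ext i j
  fin_cases i <;> fin_cases j <;> simp

omit [ValuativeRel F] in
/-- **`C(γ_n) = C(γτ)`**: the deep element `γ_n = z·1 + (zϖⁿ)·γτ` (`zϖⁿ ≠ 0`) has the same centraliser as the companion matrix `γτ`. [cite: LabesseLanglands1979, §2 p. 7] -/
theorem centralizer_deep_eq_centralizer_companion {u v z b : F} (hb : b ≠ 0) {γn γτ : GL (Fin 2) F}
    (hγn : (γn : Matrix (Fin 2) (Fin 2) F) = !![z, b * v; b, z + b * u]) (hγτ : (γτ : Matrix (Fin 2) (Fin 2) F) = !![0, v; 1, u]) :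
    Subgroup.centralizer ({γn} : Set (GL (Fin 2) F)) = Subgroup.centralizer ({γτ} : Set (GL (Fin 2) F)) := by
  ext g
  rw [Subgroup.mem_centralizer_singleton_iff, Subgroup.mem_centralizer_singleton_iff, Units.ext_iff, Units.ext_iff, Units.val_mul, Units.val_mul,
    Units.val_mul, Units.val_mul, hγn, regRep_eq_smul_one_add_smul, ← hγτ, Matrix.mul_add, Matrix.add_mul, Matrix.mul_smul, Matrix.smul_mul,
    Matrix.mul_smul, Matrix.smul_mul, Matrix.mul_one, Matrix.one_mul, add_right_inj]
  constructor
  · intro h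
    have := congrArg (fun M : Matrix (Fin 2) (Fin 2) F => b⁻¹ • M) h
    simpa only [smul_smul, inv_mul_cancel₀ hb, one_smul] using this
  · intro h
    rw [h]

omit [ValuativeRel F] in
/-- **The torus is commutative**: two elements of `C(γτ)` commute (both are `c·1 + e·γτ`, ★ `exists_coe_eq_regRep_of_mem_centralizer_companion`).
[cite: LabesseLanglands1979, §2 p. 7] -/
theorem mul_comm_of_mem_centralizer_companion {u v : F} {γτ : GL (Fin 2) F} (hγτ : (γτ : Matrix (Fin 2) (Fin 2) F) = !![0, v; 1, u])
    {s t : GL (Fin 2) F} (hs : s ∈ Subgroup.centralizer ({γτ} : Set (GL (Fin 2) F))) (ht : t ∈ Subgroup.centralizer ({γτ} : Set (GL (Fin 2) F))) :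
    s * t = t * s := by
  obtain ⟨c, e, hsc⟩ := exists_coe_eq_regRep_of_mem_centralizer_companion hγτ hs
  obtain ⟨c', e', htc⟩ := exists_coe_eq_regRep_of_mem_centralizer_companion hγτ ht
  refine Units.ext ?_
  rw [Units.val_mul, Units.val_mul, hsc, htc, Matrix.mul_fin_two, Matrix.mul_fin_two]
  ext i j
  fin_cases i <;> fin_cases j <;> simp <;> ring

include hϖ in
/-- **Integrality test through a shell conjugate**: if `t ∈ C(γτ)` (`u v ∈ 𝒪`) and `r_m⁻¹ t r_m ∈ GL₂(𝒪)` (`r_m = diag(1, ϖ^m)`), then `t ∈ GL₂(𝒪)` —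
the shell conjugate of `t = c + eτ` is `(c, evϖ^m; eϖ^{−m}, c + eu)`, whose integrality forces `c, e ∈ 𝒪`. [cite: LabesseLanglands1979, §2 (2.1) p. 8] -/
theorem mem_glInt_of_mem_centralizer_companion_of_shellConj_mem [IsDiscreteValuationRing 𝒪[F]] {u v : F} (hu : u ∈ 𝒪[F]) (hv : v ∈ 𝒪[F])
    {γτ : GL (Fin 2) F} (hγτ : (γτ : Matrix (Fin 2) (Fin 2) F) = !![0, v; 1, u]) {t : GL (Fin 2) F}
    (ht : t ∈ Subgroup.centralizer ({γτ} : Set (GL (Fin 2) F))) {gm : GL (Fin 2) F} {m : ℕ}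
    (hgm : (gm : Matrix (Fin 2) (Fin 2) F) = Matrix.diagonal ![1, ϖ ^ m]) (hK : gm⁻¹ * t * gm ∈ glInt 2 F) : t ∈ glInt 2 F := by
  obtain ⟨c, e, htc⟩ := exists_coe_eq_regRep_of_mem_centralizer_companion hγτ ht
  have hc0 : ϖ ^ m ≠ 0 := pow_ne_zero _ hϖ.ne_zero
  have hsh := coe_inv_mul_torus_mul_of_coe_eq_diagonal u v c e htc hgm hc0
  have hint := ((mem_glInt_iff _).1 hK).1
  have hdet := valuation_det_eq_one_of_mem_glInt hK
  rw [hsh] at hint hdet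
  have hcO : c ∈ 𝒪[F] := by simpa using hint 0 0
  have heO : e ∈ 𝒪[F] := by
    have h := hint 1 0
    simp only [Fin.isValue, of_apply, cons_val', cons_val_zero, cons_val_fin_one, cons_val_one] at h
    have : e = e * (ϖ ^ m)⁻¹ * ϖ ^ m := by rw [mul_assoc, inv_mul_cancel₀ hc0, mul_one]
    rw [this]
    exact Subring.mul_mem _ h (hϖ.pow_mem m)
  refine mem_glInt_of_isIntegralMatrix (fun i j => ?_) ?_
  · rw [htc]
    fin_cases i <;> fin_cases j
    · simpa using hcO
    · simpa using Subring.mul_mem _ heO hv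
    · simpa using heO
    · simpa using Subring.add_mem _ hcO (Subring.mul_mem _ heO hu)
  · rw [htc, Matrix.det_fin_two]
    rw [Matrix.det_fin_two] at hdet
    simp only [Fin.isValue, of_apply, cons_val', cons_val_zero, cons_val_fin_one, cons_val_one] at hdet ⊢
    rw [← hdet]
    congr 1
    field_simp

omit [ValuativeRel F] in
/-- The discriminant of a deep element: `tr(γ)² − 4 det(γ) = b²(u² + 4v)` for `γ = (z, bv; b, z + bu)`. [cite: LabesseLanglands1979, §2 p. 7] -/
theorem trace_sq_sub_four_mul_det_regRep (u v z b : F) {γ : GL (Fin 2) F} (hγ : (γ : Matrix (Fin 2) (Fin 2) F) = !![z, b * v; b, z + b * u]) :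
    (γ : Matrix (Fin 2) (Fin 2) F).trace ^ 2 - 4 * (γ : Matrix (Fin 2) (Fin 2) F).det = b ^ 2 * (u ^ 2 + 4 * v) := by
  rw [hγ, Matrix.trace_fin_two, Matrix.det_fin_two]
  simp
  ring

omit [ValuativeRel F] in
/-- The characteristic polynomial of `γ = (z, bv; b, z + bu)` at `c` is the NORM FORM `N(p + qτ) = p² + pqu − q²v` at `(p, q) = (c − z, −b)`. [cite: LabesseLanglands1979, §2 p. 7] -/
theorem eval_charpoly_regRep (u v z b c : F) {γ : GL (Fin 2) F} (hγ : (γ : Matrix (Fin 2) (Fin 2) F) = !![z, b * v; b, z + b * u]) :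
    ((γ : Matrix (Fin 2) (Fin 2) F).charpoly).eval c = (c - z) ^ 2 + (c - z) * (-b) * u - (-b) ^ 2 * v := by
  rw [Matrix.charpoly_fin_two, hγ, Matrix.trace_fin_two, Matrix.det_fin_two]
  simp
  ring

include hϖ in
/-- **The second regularity guard of (HC₁^P)**: `charpoly(γ_n)(c) ≠ 0` for every `c` — an irreducible (Eisenstein, hence anisotropic: ★ `eq_zero_of_quadNormForm_eq_zero`)
quadratic has no root (`b = zϖⁿ ≠ 0`). [cite: LabesseLanglands1979, §2 p. 7] -/
theorem eval_charpoly_regRep_ne_zero {u v : F} (hE : ∀ p q : F, valuation F (p ^ 2 + p * q * u - q ^ 2 * v) ≤ 1 → p ∈ 𝒪[F] ∧ q ∈ 𝒪[F])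
    {z b : F} (hb : b ≠ 0) (c : F) {γ : GL (Fin 2) F} (hγ : (γ : Matrix (Fin 2) (Fin 2) F) = !![z, b * v; b, z + b * u]) :
    ((γ : Matrix (Fin 2) (Fin 2) F).charpoly).eval c ≠ 0 := by
  rw [eval_charpoly_regRep u v z b c hγ]
  intro h
  exact hb (neg_eq_zero.1 (eq_zero_of_quadNormForm_eq_zero hϖ hE h).2)

end Torus

end Summit.HodgeConjecture.HodgeConjecture.Cruxes.H413.K2E3GLTwoRamifiedShellShift

end
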